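import Literature.NumberTheory.LFunctions.DirichletLFunctionLogDerivBound
import Literature.NumberTheory.LFunctions.SiegelExceptionalZeroBound
import Literature.NumberTheory.LFunctions.ZetaZeroFreeRegion
import Literature.NumberTheory.LFunctions.ZetaLogDerivDisc
import Literature.NumberTheory.LFunctions.SiegelWalfisz
import HarnessLib

/-!
# The Vinogradov–Korobov zero-free region for Dirichlet `L`-functions (Khale 2024) and its
# uniform consequences for moduli `q ≤ (log X)^A`

Topic `Literature/NumberTheory/LFunctions`.  This file vendors ONE printed theorem as a named fact
(`def … : Prop`, D-0014) and PROVES everything else.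

* `Khale2024_zeroFreeRegion` — NAMED FACT: T. Khale, *An explicit Vinogradov–Korobov zero-free
  region for Dirichlet L-functions*, Q. J. Math. 75 (2024) 299–332 (arXiv:2210.06457v1), Theorem 1.1,
  display (1.2): for `q ≥ 3` and any Dirichlet character `χ` (mod `q`), `L(σ + it, χ) ≠ 0` for
  `σ ≥ 1 − 1/(10.5 log q + 61.5 (log|t|)^{2/3} (log log|t|)^{1/3})`, `|t| ≥ 10`.
  (The first explicit form of the Vinogradov–Korobov region for `L(s, χ)`; the non-explicit region
  `σ ≥ 1 − c'/(log q + (log|t|)^{2/3}(log log|t|)^{1/3})` is stated by Montgomery, *Topics in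
  Multiplicative Number Theory*, p. 176, and proved in Khale's Appendix B.)  Its proof (Ford's
  zero-detector with the Richert–Ford bound for the Hurwitz zeta function) is not in the tree.

  **STATUS (bad-split review, 2026-08-15).**  (i) The statement is faithful to the source (arXiv v1
  p. 1; the published version, Q. J. Math. 75 (2024), has the same constants per its zbMATH review).
  (ii) Its proof AS PRINTED is a theory plus numerics — McCurley's explicit classical region (Khale
  (2.3)) for `|t| ≤ e^{1944}`, Ford's explicit Hurwitz bound `A = 76.2`, `B = 4.45` (Khale (2.4)),
  and the bootstrapping zero-detector Theorem 3.1 (§§4–10, App. A) — none of it in the tree for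
  `L(s, χ)`; it is not expected to be discharged.  (iii) NO theorem of the tree uses the explicit
  constants: every consumer is an `…_of_vk` theorem specialised through `hasVKZeroFreeRegion_of_khale`,
  and the INEXPLICIT region is now PROVED in the tree —
  `VKZeta.exists_hasVKZeroFreeRegion : ∃ c > 0, HasVKZeroFreeRegion c 21`
  (`VinogradovZetaSumEstimate.lean`; also `VinogradovZetaSum.hasVKZeroFreeRegion_of_vmvtBound` with
  `vmvtBound_thirtyTwo`, `VinogradovZetaSum.lean` / `VinogradovMeanValueTheorem.lean`), from
  Vinogradov's mean value theorem and Ivić's Theorem 6.2 for the shifted zeta sums, through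
  `RichertBoundsFromExpSum.lean` and `VinogradovKorobovFromRichert.lean` (which import THIS file for the
  predicate `HasVKZeroFreeRegion`, so that proof cannot be restated here).  New work should therefore
  take `(hc : 0 < c) (hVK : HasVKZeroFreeRegion c T₀)` and close with that theorem
  (`obtain ⟨c, hc, hVK⟩ := VKZeta.exists_hasVKZeroFreeRegion`), never `(hK : Khale2024_zeroFreeRegion)`;
  the `…_of_khale` specialisations in this and 24 other files are legacy, to be deleted together with
  this named fact once no file references them (first instance of the pattern:
  `MatomakiRadziwillTao2015_liouvilleDistLowerBound_holds`, `TaoLogChowlaProofs.lean`).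

* `HasVKZeroFreeRegion c T₀` — a DEFINITION (predicate in `c, T₀`, not a named fact): the
  Vinogradov–Korobov region in its inexplicit printed shape, `L(σ + it, χ) ≠ 0` for `q ≥ 3`,
  `|t| ≥ T₀`, `σ ≥ 1 − c/(log q + (log|t|)^{2/3}(log log|t|)^{1/3})` (Khale (1.4) = Montgomery,
  *Ten lectures*, p. 176, is `∃ c > 0, HasVKZeroFreeRegion c 10`).  Khale's Theorem 1.1 gives
  `HasVKZeroFreeRegion (1/61.5) 10` (`hasVKZeroFreeRegion_of_khale`), and every consumer
  below is proved in the form `…_of_vk (hc : 0 < c) (hVK : HasVKZeroFreeRegion c T₀)` — any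
  constant, any starting height — with the `Khale2024_zeroFreeRegion` form as its specialisation, so
  that an inexplicit proof of the region (Vinogradov's method with unspecified constants) discharges
  the whole chain `VK region → twisted prime number theorem → its users` as well.

Everything below is PROVED from this fact and the tree (classical region MV Thm 11.3
`DirichletZFR.exists_zeroFree`, Siegel's theorem MV Cor. 11.15 `Siegel.exists_one_sub_realZero_ge`,
the de la Vallée-Poussin region for `ζ₁ = (s−1)ζ` `classicalZFRData_riemannZeta`, the Lemma-α
packages MV Lemma 11.1 `DirichletZFR.exists_logDeriv_package` and MV Lemma 12.1
`exists_norm_logDeriv_riemannZeta₁_sub_sum_le`), in the shape consumed by twisted prime number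
theorems at a fixed scale `X` (`TwistedVonMangoldtSum.lean`, Lichtman 2020 Lemma 4.5 =
Matomäki–Radziwiłł 2015 Lemma 2 with characters):

* `VKDirichlet.eventually_LFunction_ne_zero` — for `A > 0`, `η > 2/3`: for all large `X`, every
  `q ≤ (log X)^A`, every `χ ≠ χ₀` mod `q`: `L(s, χ) ≠ 0` on `|t| ≤ 3X`, `σ ≥ 1 − (log X)^{-η}`
  (Khale for `|t| ≥ 10`; the classical region and Siegel's bound `1 − β ≥ κ(ε) q^{-ε}`, `ε = η/(2A)`,
  for `|t| < 10`; ineffective through Siegel, as every `≪_A` in this range);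
* `VKDirichlet.eventually_riemannZeta₁_ne_zero` — the same for `ζ₁` (Khale at `q = 3`, `χ = χ₀`,
  since `L(s, χ₀ mod 3) = (1 − 3^{-s}) ζ(s)`; de la Vallée-Poussin for `|t| < 10`);
* `VKDirichlet.exists_norm_logDeriv_LFunction_le` — `‖L'/L(s, χ)‖ ≤ C (log X)³` for `χ ≠ χ₀`,
  `q ≤ (log X)^A`, `|t| ≤ 2X`, `1 − (log X)^{-η}/2 ≤ σ ≤ 2` (`2/3 < η ≤ 1`), from MV Lemma 11.1:
  `L'/L = ∑_a m(a)/(s − a) + O(ℒ)`, `∑ m(a) ≪ ℒ²`, `|s − a| ≥ (log X)^{-η}/2`;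
* `VKDirichlet.exists_norm_logDeriv_riemannZeta₁_le`, `VKDirichlet.exists_norm_logDeriv_LFunctionTrivChar₁_le`
  — the same for `ζ₁'/ζ₁` (MV Lemma 12.1 and Jensen's count) and for Mathlib's entire
  `L₁(s, χ₀) = (s − 1) L(s, χ₀) = ζ₁(s) ∏_{p ∣ q}(1 − p^{-s})` (`+ 3 log q`, `SiegelWalfisz.lean`).

## References

* T. Khale, *An explicit Vinogradov–Korobov zero-free region for Dirichlet L-functions*, Q. J.
  Math. 75 (2024), no. 1, 299–332, doi:10.1093/qmath/haae010; arXiv:2210.06457v1 (numbering used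
  here). [Khale2024]
* H. L. Montgomery, R. C. Vaughan, *Multiplicative Number Theory I*, CUP 2007, Thm 11.3, Cor. 11.15,
  Lemma 11.1, Lemma 12.1. [MontgomeryVaughan2007]
* J. D. Lichtman, *Averages of the Möbius function on shifted primes*, Q. J. Math. (2021),
  arXiv:2009.08969, Lemma 4.5 (the consumer). [Lichtman2020]
-/

noncomputable section

open Complex Filter Topology Metric Set Finset

namespace Literature.NumberTheory.LFunctions

/-- NAMED FACT — **Khale 2024, Theorem 1.1, (1.2)** (explicit Vinogradov–Korobov zero-free region
for Dirichlet `L`-functions), as printed: "Let `q ≥ 3`, and let `χ (mod q)` be a Dirichlet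
character. The Dirichlet `L`-function `L(σ + it, χ)` does not vanish in the region
`σ ≥ 1 − 1/(10.5 log q + 61.5 (log|t|)^{2/3} (log log|t|)^{1/3})`, `|t| ≥ 10`."
Rendering: `χ : DirichletCharacter ℂ q` arbitrary (principal and imprimitive characters included, as
in print), `L(s, χ)` is Mathlib's `DirichletCharacter.LFunction`, `s = σ + it` with `σ = Re s`,
`t = Im s`; real powers are `Real.rpow`.  Users take `(h : Khale2024_zeroFreeRegion)` — but see the
STATUS note in the module docstring: no theorem of the tree needs these explicit constants, and the
inexplicit region `∃ c > 0, HasVKZeroFreeRegion c 21` is PROVED (`VKZeta.exists_hasVKZeroFreeRegion`,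
`VinogradovZetaSumEstimate.lean`); new consumers should use that, through the `…_of_vk` theorems.
[cite: Khale2024, Theorem 1.1 (1.2)] -/
def Khale2024_zeroFreeRegion : Prop :=
  ∀ (q : ℕ) [NeZero q], 3 ≤ q → ∀ (χ : DirichletCharacter ℂ q) (s : ℂ), 10 ≤ |s.im| →
    1 - 1 / (10.5 * Real.log q +
        61.5 * Real.log |s.im| ^ (2 / 3 : ℝ) * Real.log (Real.log |s.im|) ^ (1 / 3 : ℝ)) ≤ s.re →
      χ.LFunction s ≠ 0

namespace VKDirichlet

/-! ### Elementary inequalities at a large scale `X` -/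

/-- `exp 1 ≤ 10`, hence `1 ≤ log 10`. [folklore] -/
theorem one_le_log_ten : 1 ≤ Real.log 10 := by
  rw [Real.le_log_iff_exp_le (by norm_num)]
  have := Real.exp_one_lt_d9
  linarith

/-- For `|t| ≥ 10`: `1 ≤ log|t|` and `0 ≤ log log|t|`. [folklore] -/
theorem one_le_log_abs {t : ℝ} (ht : 10 ≤ |t|) : 1 ≤ Real.log |t| ∧ 0 ≤ Real.log (Real.log |t|) := by
  have h1 : 1 ≤ Real.log |t| :=
    one_le_log_ten.trans (Real.log_le_log (by norm_num) ht)
  exact ⟨h1, Real.log_nonneg h1⟩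

/-- Khale's denominator is positive for `|t| ≥ 10`. [folklore] -/
theorem khale_den_pos (q : ℕ) {t : ℝ} (ht : 10 ≤ |t|) :
    0 < 10.5 * Real.log q +
      61.5 * Real.log |t| ^ (2 / 3 : ℝ) * Real.log (Real.log |t|) ^ (1 / 3 : ℝ) := by
  obtain ⟨h1, h2⟩ := one_le_log_abs ht
  have hq : 0 ≤ Real.log q := Real.log_natCast_nonneg q
  have h3 : 0 < Real.log |t| ^ (2 / 3 : ℝ) := Real.rpow_pos_of_pos (by linarith) _
  have h4 : 0 ≤ Real.log (Real.log |t|) ^ (1 / 3 : ℝ) := Real.rpow_nonneg h2 _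
  have h5 : 0 ≤ 61.5 * Real.log |t| ^ (2 / 3 : ℝ) * Real.log (Real.log |t|) ^ (1 / 3 : ℝ) := by
    positivity
  -- if `log log |t| = 0` the second term vanishes but then we still need positivity: use `|t| ≥ 10 > e^e`?
  -- Instead: `log |t| ≥ log 10 > 2 > 1`, so `log log |t| > 0`.
  have h6 : 1 < Real.log |t| := by
    have h10 : Real.exp 1 < 10 := by have := Real.exp_one_lt_d9; linarith
    have : 1 < Real.log 10 := by
      rw [Real.lt_log_iff_exp_lt (by norm_num)]; exact h10
    exact this.trans_le (Real.log_le_log (by norm_num) ht)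
  have h7 : 0 < Real.log (Real.log |t|) := Real.log_pos h6
  have h8 : 0 < Real.log (Real.log |t|) ^ (1 / 3 : ℝ) := Real.rpow_pos_of_pos h7 _
  have h9 : 0 < 61.5 * Real.log |t| ^ (2 / 3 : ℝ) * Real.log (Real.log |t|) ^ (1 / 3 : ℝ) := by
    positivity
  linarith

/-- `log q ≤ A log log X` for `1 ≤ q ≤ (log X)^A` (`log X > 0`). [folklore] -/
theorem log_le_of_le_rpow {q : ℕ} {A L : ℝ} (hL : 0 < L) (hq : 1 ≤ q) (hqA : (q : ℝ) ≤ L ^ A) :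
    Real.log q ≤ A * Real.log L := by
  have hq0 : (0 : ℝ) < q := by exact_mod_cast hq
  calc Real.log q ≤ Real.log (L ^ A) := Real.log_le_log hq0 hqA
    _ = A * Real.log L := Real.log_rpow hL A

/-- **Khale's width dominates `(log X)^{-η}`** for `η > 2/3`: for all large `X`, all
`1 ≤ q ≤ (log X)^A` and `10 ≤ |t| ≤ 3X`,
`(log X)^{-η} ≤ 1/(10.5 log q + 61.5 (log|t|)^{2/3} (log log|t|)^{1/3})`.
(With `μ = (η − 2/3)/2`: `log q ≤ A log log X ≤ (A/μ)(log X)^μ`, `log|t| ≤ 2 log X`,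
`log log|t| ≤ (2 log X)^{3μ}/(3μ)`, so the denominator is `≤ C₁ (log X)^{2/3+μ} ≤ (log X)^η` once
`(log X)^μ ≥ C₁`.) [folklore] -/
theorem eventually_rpow_le_khale_width {A η : ℝ} (hA : 0 < A) (hη : 2 / 3 < η) :
    ∀ᶠ X : ℝ in atTop, ∀ q : ℕ, 1 ≤ q → (q : ℝ) ≤ Real.log X ^ A → ∀ t : ℝ, 10 ≤ |t| →
      |t| ≤ 3 * X →
        Real.log X ^ (-η) ≤ 1 / (10.5 * Real.log q +
          61.5 * Real.log |t| ^ (2 / 3 : ℝ) * Real.log (Real.log |t|) ^ (1 / 3 : ℝ)) := by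
  set μ : ℝ := (η - 2 / 3) / 2 with hμdef
  have hμ : 0 < μ := by rw [hμdef]; linarith
  have h3μ : 0 < 3 * μ := by positivity
  set C₁ : ℝ := 10.5 * A / μ + 61.5 * (2 : ℝ) ^ (2 / 3 + μ) / (3 * μ) ^ (1 / 3 : ℝ) with hC₁def
  have hC₁ : 0 < C₁ := by positivity
  filter_upwards [eventually_ge_atTop (3 : ℝ),
    Real.tendsto_log_atTop.eventually_ge_atTop (max 2 (C₁ ^ (1 / μ)))] with X hX hLge
  intro q hq hqA t ht htX
  set L : ℝ := Real.log X with hLdef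
  have hL2 : 2 ≤ L := (le_max_left _ _).trans hLge
  have hL0 : 0 < L := by linarith
  have hL1 : 1 ≤ L := by linarith
  have hLC : C₁ ^ (1 / μ) ≤ L := (le_max_right _ _).trans hLge
  -- `C₁ ≤ L ^ μ`
  have hC₁L : C₁ ≤ L ^ μ := by
    have h := Real.rpow_le_rpow (Real.rpow_nonneg hC₁.le _) hLC hμ.le
    rwa [← Real.rpow_mul hC₁.le, one_div_mul_cancel hμ.ne', Real.rpow_one] at h
  obtain ⟨hlt1, hllt0⟩ := one_le_log_abs ht
  have hD := khale_den_pos q ht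
  -- `log q ≤ (A/μ) L^μ`
  have hlogq : Real.log q ≤ A / μ * L ^ μ := by
    have h1 := log_le_of_le_rpow hL0 hq hqA
    have h2 : Real.log L ≤ L ^ μ / μ := Real.log_le_rpow_div hL0.le hμ
    calc Real.log q ≤ A * Real.log L := h1
      _ ≤ A * (L ^ μ / μ) := mul_le_mul_of_nonneg_left h2 hA.le
      _ = A / μ * L ^ μ := by ring
  -- `log |t| ≤ 2L`
  have ht0 : 0 < |t| := by linarith
  have hlogt : Real.log |t| ≤ 2 * L := by
    have h1 : Real.log |t| ≤ Real.log (3 * X) := Real.log_le_log ht0 htX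
    have h2 : Real.log (3 * X) = Real.log 3 + L := by
      rw [Real.log_mul (by norm_num) (by linarith)]
    have h3 : Real.log 3 ≤ 2 := by
      have := Real.log_le_sub_one_of_pos (show (0:ℝ) < 3 by norm_num); linarith
    linarith
  have h2L : 0 < 2 * L := by linarith
  -- `(log|t|)^{2/3} ≤ (2L)^{2/3}`
  have hA1 : Real.log |t| ^ (2 / 3 : ℝ) ≤ (2 * L) ^ (2 / 3 : ℝ) :=
    Real.rpow_le_rpow (by linarith) hlogt (by norm_num)
  -- `(log log|t|)^{1/3} ≤ (2L)^μ / (3μ)^{1/3}`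
  have hA2 : Real.log (Real.log |t|) ^ (1 / 3 : ℝ) ≤ (2 * L) ^ μ / (3 * μ) ^ (1 / 3 : ℝ) := by
    have h1 : Real.log (Real.log |t|) ≤ Real.log (2 * L) :=
      Real.log_le_log (by linarith) hlogt
    have h2 : Real.log (2 * L) ≤ (2 * L) ^ (3 * μ) / (3 * μ) := Real.log_le_rpow_div h2L.le h3μ
    have h3 : Real.log (Real.log |t|) ^ (1 / 3 : ℝ) ≤ ((2 * L) ^ (3 * μ) / (3 * μ)) ^ (1 / 3 : ℝ) :=
      Real.rpow_le_rpow hllt0 (h1.trans h2) (by norm_num)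
    refine h3.trans (le_of_eq ?_)
    rw [Real.div_rpow (Real.rpow_nonneg h2L.le _) h3μ.le, ← Real.rpow_mul h2L.le]
    congr 2
    ring
  -- the denominator is at most `C₁ L^{2/3+μ}`
  have hpow1 : (2 * L) ^ (2 / 3 : ℝ) * (2 * L) ^ μ = (2 : ℝ) ^ (2 / 3 + μ) * L ^ (2 / 3 + μ) := by
    rw [← Real.rpow_add h2L, Real.mul_rpow (by norm_num) hL0.le]
  have hLμ : L ^ μ ≤ L ^ (2 / 3 + μ) :=
    Real.rpow_le_rpow_of_exponent_le hL1 (by linarith)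
  have hLpos : 0 < L ^ (2 / 3 + μ) := Real.rpow_pos_of_pos hL0 _
  have hden_le : 10.5 * Real.log q +
      61.5 * Real.log |t| ^ (2 / 3 : ℝ) * Real.log (Real.log |t|) ^ (1 / 3 : ℝ) ≤
        C₁ * L ^ (2 / 3 + μ) := by
    have hB : 61.5 * Real.log |t| ^ (2 / 3 : ℝ) * Real.log (Real.log |t|) ^ (1 / 3 : ℝ) ≤
        61.5 * ((2 * L) ^ (2 / 3 : ℝ) * ((2 * L) ^ μ / (3 * μ) ^ (1 / 3 : ℝ))) := by
      rw [mul_assoc]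
      refine mul_le_mul_of_nonneg_left ?_ (by norm_num)
      exact mul_le_mul hA1 hA2 (Real.rpow_nonneg hllt0 _) (Real.rpow_nonneg h2L.le _)
    have hB' : 61.5 * ((2 * L) ^ (2 / 3 : ℝ) * ((2 * L) ^ μ / (3 * μ) ^ (1 / 3 : ℝ))) =
        61.5 * (2 : ℝ) ^ (2 / 3 + μ) / (3 * μ) ^ (1 / 3 : ℝ) * L ^ (2 / 3 + μ) := by
      rw [mul_div_assoc', hpow1]; ring
    have hA' : 10.5 * Real.log q ≤ 10.5 * A / μ * L ^ (2 / 3 + μ) := by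
      calc 10.5 * Real.log q ≤ 10.5 * (A / μ * L ^ μ) :=
            mul_le_mul_of_nonneg_left hlogq (by norm_num)
        _ ≤ 10.5 * (A / μ * L ^ (2 / 3 + μ)) := by
            refine mul_le_mul_of_nonneg_left ?_ (by norm_num)
            exact mul_le_mul_of_nonneg_left hLμ (by positivity)
        _ = 10.5 * A / μ * L ^ (2 / 3 + μ) := by ring
    calc _ ≤ 10.5 * A / μ * L ^ (2 / 3 + μ) +
          61.5 * (2 : ℝ) ^ (2 / 3 + μ) / (3 * μ) ^ (1 / 3 : ℝ) * L ^ (2 / 3 + μ) := by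
          rw [← hB']; exact add_le_add hA' hB
      _ = C₁ * L ^ (2 / 3 + μ) := by rw [hC₁def]; ring
  -- hence at most `L^η`
  have hden_le' : 10.5 * Real.log q +
      61.5 * Real.log |t| ^ (2 / 3 : ℝ) * Real.log (Real.log |t|) ^ (1 / 3 : ℝ) ≤ L ^ η := by
    calc _ ≤ C₁ * L ^ (2 / 3 + μ) := hden_le
      _ ≤ L ^ μ * L ^ (2 / 3 + μ) := mul_le_mul_of_nonneg_right hC₁L hLpos.le
      _ = L ^ η := by rw [← Real.rpow_add hL0]; congr 1; rw [hμdef]; ring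
  rw [Real.rpow_neg hL0.le, ← one_div]
  exact one_div_le_one_div_of_le hD hden_le'

/-- **The classical width dominates `(log X)^{-η}` at bounded height**: for `c > 0`, `η > 0`, for all
large `X`, `1 ≤ q ≤ (log X)^A` and `|t| ≤ 10`: `(log X)^{-η} < c/(log q + log(|t| + 4))`. [folklore] -/
theorem eventually_rpow_lt_classical_width {A η c : ℝ} (hA : 0 < A) (hη : 0 < η) (hc : 0 < c) :
    ∀ᶠ X : ℝ in atTop, ∀ q : ℕ, 1 ≤ q → (q : ℝ) ≤ Real.log X ^ A → ∀ t : ℝ, |t| ≤ 10 →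
      Real.log X ^ (-η) < c / (Real.log q + Real.log (|t| + 4)) := by
  have hη2 : 0 < η / 2 := by positivity
  set C₁ : ℝ := (2 * A / η + 3) / c + 1 with hC₁def
  have hC₁ : 0 < C₁ := by positivity
  filter_upwards [Real.tendsto_log_atTop.eventually_ge_atTop (max 2 (C₁ ^ (2 / η)))] with X hLge
  intro q hq hqA t ht
  set L : ℝ := Real.log X with hLdef
  have hL2 : 2 ≤ L := (le_max_left _ _).trans hLge
  have hL0 : 0 < L := by linarith
  have hL1 : 1 ≤ L := by linarith
  have hLC : C₁ ^ (2 / η) ≤ L := (le_max_right _ _).trans hLge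
  have hC₁L : C₁ ≤ L ^ (η / 2) := by
    have h := Real.rpow_le_rpow (Real.rpow_nonneg hC₁.le _) hLC hη2.le
    rwa [← Real.rpow_mul hC₁.le, show 2 / η * (η / 2) = 1 by field_simp, Real.rpow_one] at h
  have hℒ := DirichletZFR.ell_pos q t
  -- `log q + log(|t|+4) ≤ (2A/η + 3) L^{η/2}`
  have hlogq : Real.log q ≤ 2 * A / η * L ^ (η / 2) := by
    have h1 := log_le_of_le_rpow hL0 hq hqA
    have h2 : Real.log L ≤ L ^ (η / 2) / (η / 2) := Real.log_le_rpow_div hL0.le hη2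
    calc Real.log q ≤ A * Real.log L := h1
      _ ≤ A * (L ^ (η / 2) / (η / 2)) := mul_le_mul_of_nonneg_left h2 hA.le
      _ = 2 * A / η * L ^ (η / 2) := by field_simp
  have hLη1 : 1 ≤ L ^ (η / 2) := Real.one_le_rpow hL1 hη2.le
  have hlogt : Real.log (|t| + 4) ≤ 3 * L ^ (η / 2) := by
    have h1 : Real.log (|t| + 4) ≤ Real.log 14 := Real.log_le_log (by positivity) (by linarith)
    have h2 : Real.log 14 ≤ 3 := by
      rw [Real.log_le_iff_le_exp (by norm_num)]
      have h3 : (2.7 : ℝ) ≤ Real.exp 1 := by have := Real.exp_one_gt_d9; linarith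
      have h4 : Real.exp 1 ^ 3 = Real.exp 3 := by rw [← Real.exp_nat_mul]; norm_num
      nlinarith [pow_le_pow_left₀ (by norm_num : (0:ℝ) ≤ 2.7) h3 3]
    linarith
  have hsum : Real.log q + Real.log (|t| + 4) ≤ (2 * A / η + 3) * L ^ (η / 2) := by linarith
  -- conclude
  have hLη : L ^ (-η) * (Real.log q + Real.log (|t| + 4)) < c := by
    have h1 : L ^ (-η) * (Real.log q + Real.log (|t| + 4)) ≤
        L ^ (-η) * ((2 * A / η + 3) * L ^ (η / 2)) :=
      mul_le_mul_of_nonneg_left hsum (Real.rpow_nonneg hL0.le _)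
    have h2 : L ^ (-η) * ((2 * A / η + 3) * L ^ (η / 2)) = (2 * A / η + 3) / L ^ (η / 2) := by
      rw [mul_left_comm, ← Real.rpow_add hL0, show -η + η / 2 = -(η / 2) by ring,
        Real.rpow_neg hL0.le, ← div_eq_mul_inv]
    have h3 : (2 * A / η + 3) / L ^ (η / 2) < c := by
      rw [div_lt_iff₀ (by positivity)]
      have : (2 * A / η + 3) / c < L ^ (η / 2) := by linarith
      rw [div_lt_iff₀ hc] at this
      linarith
    linarith
  rw [lt_div_iff₀ hℒ]
  exact hLη

/-- **Siegel's width dominates `(log X)^{-η}`**: for `κ > 0`, with `ε = η/(2A)`, for all large `X`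
and `1 ≤ q ≤ (log X)^A`: `(log X)^{-η} < κ q^{-ε}` (indeed `q^{-ε} ≥ (log X)^{-η/2}`). [folklore] -/
theorem eventually_rpow_lt_siegel_width {A η κ : ℝ} (hA : 0 < A) (hη : 0 < η) (hκ : 0 < κ) :
    ∀ᶠ X : ℝ in atTop, ∀ q : ℕ, 1 ≤ q → (q : ℝ) ≤ Real.log X ^ A →
      Real.log X ^ (-η) < κ * (q : ℝ) ^ (-(η / (2 * A))) := by
  have hη2 : 0 < η / 2 := by positivity
  set C₁ : ℝ := 1 / κ + 1 with hC₁def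
  have hC₁ : 0 < C₁ := by positivity
  filter_upwards [Real.tendsto_log_atTop.eventually_ge_atTop (max 2 (C₁ ^ (2 / η)))] with X hLge
  intro q hq hqA
  set L : ℝ := Real.log X with hLdef
  have hL2 : 2 ≤ L := (le_max_left _ _).trans hLge
  have hL0 : 0 < L := by linarith
  have hLC : C₁ ^ (2 / η) ≤ L := (le_max_right _ _).trans hLge
  have hC₁L : C₁ ≤ L ^ (η / 2) := by
    have h := Real.rpow_le_rpow (Real.rpow_nonneg hC₁.le _) hLC hη2.le
    rwa [← Real.rpow_mul hC₁.le, show 2 / η * (η / 2) = 1 by field_simp, Real.rpow_one] at h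
  have hq0 : (0 : ℝ) < q := by exact_mod_cast hq
  -- `q^{-ε} ≥ (L^A)^{-ε} = L^{-η/2}`
  have h1 : L ^ (-(η / 2)) ≤ (q : ℝ) ^ (-(η / (2 * A))) := by
    have h2 : (q : ℝ) ^ (η / (2 * A)) ≤ (L ^ A) ^ (η / (2 * A)) :=
      Real.rpow_le_rpow hq0.le hqA (by positivity)
    rw [← Real.rpow_mul hL0.le, show A * (η / (2 * A)) = η / 2 by field_simp] at h2
    rw [Real.rpow_neg hq0.le, Real.rpow_neg hL0.le]
    exact inv_anti₀ (Real.rpow_pos_of_pos hq0 _) h2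
  have h3 : L ^ (-η) < κ * L ^ (-(η / 2)) := by
    rw [show -η = -(η / 2) + -(η / 2) by ring, Real.rpow_add hL0]
    refine mul_lt_mul_of_pos_right ?_ (Real.rpow_pos_of_pos hL0 _)
    rw [Real.rpow_neg hL0.le, inv_lt_iff_one_lt_mul₀ (Real.rpow_pos_of_pos hL0 _)]
    have : 1 / κ < L ^ (η / 2) := by linarith
    rw [div_lt_iff₀ hκ] at this
    linarith
  calc L ^ (-η) < κ * L ^ (-(η / 2)) := h3
    _ ≤ κ * (q : ℝ) ^ (-(η / (2 * A))) := mul_le_mul_of_nonneg_left h1 hκ.le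

/-- A non-principal Dirichlet character has modulus `q ≥ 3` (the unit groups of `ℤ/1` and `ℤ/2` are
trivial). [folklore] -/
theorem three_le_of_ne_one {q : ℕ} [NeZero q] {χ : DirichletCharacter ℂ q} (hχ : χ ≠ 1) :
    3 ≤ q := by
  by_contra h
  have h' : q < 3 := not_le.mp h
  have hq0 : q ≠ 0 := NeZero.ne q
  interval_cases q
  · exact hq0 rfl
  · exact hχ (DirichletCharacter.level_one χ)
  · apply hχ
    refine MulChar.ext' fun a ↦ ?_
    by_cases ha : IsUnit a
    · obtain ⟨u, rfl⟩ := ha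
      have hu : u = 1 := Subsingleton.elim (h := by
        rw [← Fintype.card_le_one_iff_subsingleton, ZMod.card_units_eq_totient]; decide) u 1
      rw [hu]; simp
    · rw [MulChar.map_nonunit _ ha, MulChar.map_nonunit _ ha]

/-- `(log X)^{-η} → 0`: for `b > 0`, eventually `(log X)^{-η} < b`. [folklore] -/
theorem eventually_rpow_neg_lt {η : ℝ} (hη : 0 < η) {b : ℝ} (hb : 0 < b) :
    ∀ᶠ X : ℝ in atTop, Real.log X ^ (-η) < b :=
  ((tendsto_rpow_neg_atTop hη).comp Real.tendsto_log_atTop).eventually (gt_mem_nhds hb)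

/-- At a large scale: `log q + log(|t| + 4) ≤ (A + 2) log X` for `1 ≤ q ≤ (log X)^A`, `|t| ≤ 2X`
(`X ≥ 4`, `log X ≥ 1`). [folklore] -/
theorem ell_le_of_scale {A X : ℝ} (hA : 0 < A) (hX : 4 ≤ X) (hL : 1 ≤ Real.log X) {q : ℕ}
    (hq : 1 ≤ q) (hqA : (q : ℝ) ≤ Real.log X ^ A) {t : ℝ} (ht : |t| ≤ 2 * X) :
    Real.log q + Real.log (|t| + 4) ≤ (A + 2) * Real.log X := by
  have hL0 : 0 < Real.log X := by linarith
  have h1 : Real.log q ≤ A * Real.log X := by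
    have h := log_le_of_le_rpow hL0 hq hqA
    have h2 : Real.log (Real.log X) ≤ Real.log X := by
      have := Real.log_le_sub_one_of_pos hL0; linarith
    exact h.trans (mul_le_mul_of_nonneg_left h2 hA.le)
  have h2 : Real.log (|t| + 4) ≤ 2 * Real.log X := by
    have h3 : |t| + 4 ≤ X ^ 2 := by nlinarith
    calc Real.log (|t| + 4) ≤ Real.log (X ^ 2) := Real.log_le_log (by positivity) h3
      _ = 2 * Real.log X := by rw [Real.log_pow]; norm_num
  linarith

end VKDirichlet

/-! ### The Vinogradov–Korobov region as an interface (inexplicit form) -/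

/-- **The Vinogradov–Korobov zero-free region for Dirichlet `L`-functions with constant `c`, from
height `T₀`** — a predicate in `(c, T₀)`, not a named fact: for every `q ≥ 3`, every Dirichlet
character `χ` mod `q` and every `s = σ + it` with `|t| ≥ T₀`,
`σ ≥ 1 − c/(log q + (log|t|)^{2/3}(log log|t|)^{1/3}) ⟹ L(s, χ) ≠ 0`.
Khale's display (1.4) — "there exists some absolute and effectively computable constant `c' > 0` such
that `L(σ + it, χ) ≠ 0` in the region `σ ≥ 1 − c'/(log q + (log|t|)^{2/3}(log log|t|)^{1/3})`,
`|t| ≥ 10`" (for `q ≥ 3`; attributed to Montgomery, *Ten lectures*, p. 176, and proved in Khale's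
Appendix B, Corollary B.2, with `c' = 1/104` from `|t| ≥ 3`) — reads `∃ c > 0, HasVKZeroFreeRegion c 10`;
the explicit Theorem 1.1 (1.2) gives `HasVKZeroFreeRegion (1/61.5) 10` (`hasVKZeroFreeRegion_of_khale`).
The consumers of this file are proved from `(hc : 0 < c) (hVK : HasVKZeroFreeRegion c T₀)` for ANY
constant and starting height (heights `|t| < max T₀ 10` are covered by the classical region and
Siegel's theorem), so that any proof of the region, explicit or not, feeds them.
[cite: Khale2024, (1.4) and Corollary B.2] -/
def HasVKZeroFreeRegion (c T₀ : ℝ) : Prop :=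
  ∀ (q : ℕ) [NeZero q], 3 ≤ q → ∀ (χ : DirichletCharacter ℂ q) (s : ℂ), T₀ ≤ |s.im| →
    1 - c / (Real.log q +
        Real.log |s.im| ^ (2 / 3 : ℝ) * Real.log (Real.log |s.im|) ^ (1 / 3 : ℝ)) ≤ s.re →
      χ.LFunction s ≠ 0

/-- Raising the starting height preserves a Vinogradov–Korobov region. [folklore] -/
theorem HasVKZeroFreeRegion.mono_height {c T₀ T₁ : ℝ} (h : HasVKZeroFreeRegion c T₀)
    (hT : T₀ ≤ T₁) : HasVKZeroFreeRegion c T₁ :=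
  fun q _ hq χ s ht hσ ↦ h q hq χ s (hT.trans ht) hσ

/-- **Khale's Theorem 1.1 (1.2) in the interface form**: `HasVKZeroFreeRegion (1/61.5) 10`, because
`10.5 log q + 61.5 Y ≤ 61.5 (log q + Y)` (`Y = (log|t|)^{2/3}(log log|t|)^{1/3} ≥ 0` for `|t| ≥ 10`).
[cite: Khale2024, Theorem 1.1 (1.2)] -/
theorem hasVKZeroFreeRegion_of_khale (hK : Khale2024_zeroFreeRegion) :
    HasVKZeroFreeRegion (1 / 61.5) 10 := by
  intro q _ hq χ s ht hσ
  refine hK q hq χ s ht (le_trans ?_ hσ)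
  obtain ⟨hl1, hll0⟩ := VKDirichlet.one_le_log_abs ht
  set Y : ℝ := Real.log |s.im| ^ (2 / 3 : ℝ) * Real.log (Real.log |s.im|) ^ (1 / 3 : ℝ) with hYdef
  have hY : 0 ≤ Y := mul_nonneg (Real.rpow_nonneg (by linarith) _) (Real.rpow_nonneg hll0 _)
  have hD := VKDirichlet.khale_den_pos q ht
  have hlogq : 0 ≤ Real.log q := Real.log_natCast_nonneg q
  have hDY : 10.5 * Real.log q +
      61.5 * Real.log |s.im| ^ (2 / 3 : ℝ) * Real.log (Real.log |s.im|) ^ (1 / 3 : ℝ) =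
        10.5 * Real.log q + 61.5 * Y := by rw [hYdef]; ring
  rw [hDY] at hD ⊢
  have h3 : (1 : ℝ) / (61.5 * (Real.log q + Y)) ≤ 1 / (10.5 * Real.log q + 61.5 * Y) :=
    one_div_le_one_div_of_le hD (by nlinarith)
  rw [div_div]
  linarith

namespace VKDirichlet

/-- **Any Vinogradov–Korobov width dominates `(log X)^{-η}`** for `η > 2/3` and `c > 0`: for all large
`X`, all `1 ≤ q ≤ (log X)^A` and `10 ≤ |t| ≤ 3X`,
`(log X)^{-η} ≤ c/(log q + (log|t|)^{2/3}(log log|t|)^{1/3})`.  (From `eventually_rpow_le_khale_width`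
at an exponent `2/3 < η' < η`: `1/(10.5 log q + 61.5 Y) ≤ (1/10.5)/(log q + Y)` and
`(log X)^{η'−η} ≤ 10.5 c` eventually.) [folklore] -/
theorem eventually_rpow_le_vk_width {A η c : ℝ} (hA : 0 < A) (hη : 2 / 3 < η) (hc : 0 < c) :
    ∀ᶠ X : ℝ in atTop, ∀ q : ℕ, 1 ≤ q → (q : ℝ) ≤ Real.log X ^ A → ∀ t : ℝ, 10 ≤ |t| →
      |t| ≤ 3 * X →
        Real.log X ^ (-η) ≤ c / (Real.log q +
          Real.log |t| ^ (2 / 3 : ℝ) * Real.log (Real.log |t|) ^ (1 / 3 : ℝ)) := by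
  set η' : ℝ := (η + 2 / 3) / 2 with hη'def
  have hη' : 2 / 3 < η' := by rw [hη'def]; linarith
  have hηη' : 0 < η - η' := by rw [hη'def]; linarith
  filter_upwards [eventually_rpow_le_khale_width hA hη',
    eventually_rpow_neg_lt hηη' (show (0 : ℝ) < 10.5 * c by positivity),
    Real.tendsto_log_atTop.eventually_ge_atTop (1 : ℝ)] with X h1 h2 hL1
  intro q hq hqA t ht htX
  set L : ℝ := Real.log X with hLdef
  have hL0 : 0 < L := by linarith
  have hw := h1 q hq hqA t ht htX
  obtain ⟨hl1, hll0⟩ := one_le_log_abs ht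
  set Y : ℝ := Real.log |t| ^ (2 / 3 : ℝ) * Real.log (Real.log |t|) ^ (1 / 3 : ℝ) with hYdef
  have hY : 0 ≤ Y := mul_nonneg (Real.rpow_nonneg (by linarith) _) (Real.rpow_nonneg hll0 _)
  have hD := khale_den_pos q ht
  have hlogq : 0 ≤ Real.log q := Real.log_natCast_nonneg q
  have hDY : 10.5 * Real.log q +
      61.5 * Real.log |t| ^ (2 / 3 : ℝ) * Real.log (Real.log |t|) ^ (1 / 3 : ℝ) =
        10.5 * Real.log q + 61.5 * Y := by rw [hYdef]; ring
  rw [hDY] at hD hw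
  have hD' : 0 < Real.log q + Y := by nlinarith
  have hsplit : L ^ (-η) = L ^ (-(η - η')) * L ^ (-η') := by
    rw [← Real.rpow_add hL0]; congr 1; ring
  have h3 : (1 : ℝ) / (10.5 * Real.log q + 61.5 * Y) ≤ 1 / (10.5 * (Real.log q + Y)) :=
    one_div_le_one_div_of_le (by positivity) (by nlinarith)
  calc L ^ (-η) = L ^ (-(η - η')) * L ^ (-η') := hsplit
    _ ≤ (10.5 * c) * (1 / (10.5 * (Real.log q + Y))) :=
        mul_le_mul h2.le (hw.trans h3) (Real.rpow_nonneg hL0.le _) (by positivity)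
    _ = c / (Real.log q + Y) := by
        rw [mul_one_div, mul_div_mul_left _ _ (by norm_num : (10.5 : ℝ) ≠ 0)]

/-- **The classical width dominates `(log X)^{-η}` up to any fixed height**: for `c > 0`, `η > 0` and
`T ≥ 0`, for all large `X`, `1 ≤ q ≤ (log X)^A` and `|t| ≤ T`:
`(log X)^{-η} < c/(log q + log(|t| + 4))` (from `eventually_rpow_lt_classical_width` at `t = 0` with
the constant `c log 4/log(T + 4)`). [folklore] -/
theorem eventually_rpow_lt_classical_width_of_le {A η c T : ℝ} (hA : 0 < A) (hη : 0 < η)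
    (hc : 0 < c) (hT : 0 ≤ T) :
    ∀ᶠ X : ℝ in atTop, ∀ q : ℕ, 1 ≤ q → (q : ℝ) ≤ Real.log X ^ A → ∀ t : ℝ, |t| ≤ T →
      Real.log X ^ (-η) < c / (Real.log q + Real.log (|t| + 4)) := by
  have h4 : 0 < Real.log 4 := Real.log_pos (by norm_num)
  have hT4 : Real.log 4 ≤ Real.log (T + 4) := Real.log_le_log (by norm_num) (by linarith)
  set K : ℝ := Real.log (T + 4) / Real.log 4 with hKdef
  have hK1 : 1 ≤ K := by rwa [hKdef, le_div_iff₀ h4, one_mul]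
  have hK0 : 0 < K := by linarith
  filter_upwards [eventually_rpow_lt_classical_width hA hη (div_pos hc hK0)] with X h
  intro q hq hqA t ht
  have h0 := h q hq hqA 0 (by norm_num)
  rw [abs_zero, zero_add] at h0
  refine h0.trans_le ?_
  have hlogq : 0 ≤ Real.log q := Real.log_natCast_nonneg q
  have hℒ := DirichletZFR.ell_pos q t
  have hlogt : Real.log (|t| + 4) ≤ Real.log (T + 4) :=
    Real.log_le_log (by positivity) (by linarith)
  have hK4 : K * Real.log 4 = Real.log (T + 4) := by rw [hKdef]; field_simp
  have hKq : Real.log q ≤ K * Real.log q := le_mul_of_one_le_left hlogq hK1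
  rw [div_div, div_le_div_iff_of_pos_left hc (by positivity) hℒ]
  nlinarith

/-! ### The uniform zero-free rectangle at scale `X` -/

/-- **Non-principal characters, uniformly for `q ≤ (log X)^A`, from any Vinogradov–Korobov region.**
Assume `HasVKZeroFreeRegion c T₀` with `c > 0`.  For `A > 0` and `η > 2/3`, for all large `X`: every
`q ≤ (log X)^A`, every `χ ≠ χ₀` mod `q` and every `s` with `|Im s| ≤ 3X`, `Re s ≥ 1 − (log X)^{-η}` has
`L(s, χ) ≠ 0`.  Heights `|t| ≥ max T₀ 10`: the Vinogradov–Korobov region (its width exceeds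
`(log X)^{-η}`, `eventually_rpow_le_vk_width`; `q ≥ 3` as `χ ≠ χ₀`).  Heights `|t| < max T₀ 10`: by
MV Theorem 11.3 (`DirichletZFR.exists_zeroFree`, width `eventually_rpow_lt_classical_width_of_le`)
such a zero is real and `χ` is quadratic, and then Siegel's bound `1 − β ≥ κ q^{-ε}` with `ε = η/(2A)`
(MV Cor. 11.15, `Siegel.exists_one_sub_realZero_ge`) contradicts `β ≥ 1 − (log X)^{-η}` (ineffective
constant). [cite: Khale2024, (1.4)] [cite: MontgomeryVaughan2007, Theorem 11.3 and Corollary 11.15] -/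
theorem eventually_LFunction_ne_zero_of_vk {c T₀ : ℝ} (hc : 0 < c) (hVK : HasVKZeroFreeRegion c T₀)
    {A η : ℝ} (hA : 0 < A) (hη : 2 / 3 < η) :
    ∀ᶠ X : ℝ in atTop, ∀ (q : ℕ) [NeZero q], (q : ℝ) ≤ Real.log X ^ A →
      ∀ χ : DirichletCharacter ℂ q, χ ≠ 1 → ∀ s : ℂ, |s.im| ≤ 3 * X →
        1 - Real.log X ^ (-η) ≤ s.re → χ.LFunction s ≠ 0 := by
  obtain ⟨c₁, hc₁, hzf⟩ := DirichletZFR.exists_zeroFree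
  have hε : 0 < η / (2 * A) := by positivity
  obtain ⟨κ, hκ, hSiegel⟩ := Siegel.exists_one_sub_realZero_ge hε
  have hη0 : 0 < η := by linarith
  have hT : (0 : ℝ) ≤ max T₀ 10 := le_max_of_le_right (by norm_num)
  filter_upwards [eventually_rpow_le_vk_width hA hη hc,
    eventually_rpow_lt_classical_width_of_le hA hη0 hc₁ hT,
    eventually_rpow_lt_siegel_width hA hη0 hκ] with X h1 h2 h3
  intro q _ hqA χ hχ s hsX hre hzero
  have hq1 : 1 ≤ q := Nat.one_le_iff_ne_zero.2 (NeZero.ne q)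
  rcases le_or_gt (max T₀ 10) |s.im| with h10 | h10
  · have hq3 := three_le_of_ne_one hχ
    have hw := h1 q hq1 hqA s.im ((le_max_right _ _).trans h10) hsX
    exact hVK q hq3 χ s ((le_max_left _ _).trans h10) (by linarith) hzero
  · have hlt := h2 q hq1 hqA s.im h10.le
    obtain ⟨hχ2, him⟩ := hzf q χ hχ s hzero (by linarith)
    have hs : s = (s.re : ℂ) := Complex.ext (by simp) (by simp [him])
    have hβ := hSiegel q χ hχ2 hχ s.re (by rw [← hs]; exact hzero)
    have h3' := h3 q hq1 hqA
    linarith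

/-- **Non-principal characters, uniformly for `q ≤ (log X)^A`** (Khale's form of
`eventually_LFunction_ne_zero_of_vk`).  Assume Khale's Theorem 1.1.  For `A > 0` and `η > 2/3`, for all
large `X`: every `q ≤ (log X)^A`, every `χ ≠ χ₀` mod `q` and every `s` with `|Im s| ≤ 3X`,
`Re s ≥ 1 − (log X)^{-η}` has `L(s, χ) ≠ 0`.
[cite: Khale2024, Theorem 1.1] [cite: MontgomeryVaughan2007, Theorem 11.3 and Corollary 11.15] -/
theorem eventually_LFunction_ne_zero (hK : Khale2024_zeroFreeRegion) {A η : ℝ} (hA : 0 < A)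
    (hη : 2 / 3 < η) :
    ∀ᶠ X : ℝ in atTop, ∀ (q : ℕ) [NeZero q], (q : ℝ) ≤ Real.log X ^ A →
      ∀ χ : DirichletCharacter ℂ q, χ ≠ 1 → ∀ s : ℂ, |s.im| ≤ 3 * X →
        1 - Real.log X ^ (-η) ≤ s.re → χ.LFunction s ≠ 0 :=
  eventually_LFunction_ne_zero_of_vk (by norm_num) (hasVKZeroFreeRegion_of_khale hK) hA hη

/-- **`ζ₁ = (s − 1)ζ(s)` on the same rectangle, from any Vinogradov–Korobov region.**  Assume
`HasVKZeroFreeRegion c T₀` with `c > 0`.  For `η > 2/3`, for all large `X`: `ζ₁(s) ≠ 0` for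
`|Im s| ≤ 3X`, `Re s ≥ 1 − (log X)^{-η}`.  Heights `|t| ≥ max T₀ 10`: a zero of `ζ` is a zero of
`L(s, χ₀ mod 3) = (1 − 3^{-s}) ζ(s)` (Mathlib's `DirichletCharacter.LFunctionTrivChar_eq_mul_riemannZeta`),
excluded by the region at `q = 3`; heights `|t| < max T₀ 10`: the de la Vallée-Poussin region for `ζ₁`
(`classicalZFRData_riemannZeta`, MV Thm 6.6). [cite: Khale2024, (1.4)]
[cite: MontgomeryVaughan2007, Theorem 6.6] -/
theorem eventually_riemannZeta₁_ne_zero_of_vk {c T₀ : ℝ} (hc : 0 < c)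
    (hVK : HasVKZeroFreeRegion c T₀) {η : ℝ} (hη : 2 / 3 < η) :
    ∀ᶠ X : ℝ in atTop, ∀ s : ℂ, |s.im| ≤ 3 * X → 1 - Real.log X ^ (-η) ≤ s.re →
      riemannZeta₁ s ≠ 0 := by
  obtain ⟨c₀, hc₀, hzf⟩ := classicalZFRData_riemannZeta.zeroFree
  have hη0 : 0 < η := by linarith
  have hT : (0 : ℝ) ≤ max T₀ 10 := le_max_of_le_right (by norm_num)
  filter_upwards [eventually_rpow_le_vk_width one_pos hη hc,
    eventually_rpow_lt_classical_width_of_le one_pos hη0 hc₀ hT,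
    eventually_rpow_neg_lt hη0 (show (0 : ℝ) < 1 / 2 by norm_num),
    Real.tendsto_log_atTop.eventually_ge_atTop (3 : ℝ)] with X h1 h2 hhalf hL3
  intro s hsX hre hzero
  have h1A : ((1 : ℕ) : ℝ) ≤ Real.log X ^ (1 : ℝ) := by rw [Real.rpow_one, Nat.cast_one]; linarith
  have h3A : ((3 : ℕ) : ℝ) ≤ Real.log X ^ (1 : ℝ) := by rw [Real.rpow_one]; exact_mod_cast hL3
  rcases le_or_gt (max T₀ 10) |s.im| with h10 | h10
  · have h10' : 10 ≤ |s.im| := (le_max_right _ _).trans h10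
    have hs1 : s ≠ 1 := by
      rintro rfl
      have : |(1 : ℂ).im| = 0 := by simp
      linarith
    have hζ : riemannZeta s = 0 := (riemannZeta₁_eq_zero_iff hs1).1 hzero
    have hw := h1 3 (by norm_num) h3A s.im h10' hsX
    refine hVK 3 le_rfl (1 : DirichletCharacter ℂ 3) s ((le_max_left _ _).trans h10) (by linarith) ?_
    show DirichletCharacter.LFunctionTrivChar 3 s = 0
    rw [DirichletCharacter.LFunctionTrivChar_eq_mul_riemannZeta hs1, hζ, mul_zero]
  · have hlt := h2 1 le_rfl h1A s.im h10.le
    rw [Nat.cast_one, Real.log_one, zero_add] at hlt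
    refine hzf s ?_ (by linarith) hzero
    linarith

/-- **`ζ₁ = (s − 1)ζ(s)` on the same rectangle** (Khale's form of `eventually_riemannZeta₁_ne_zero_of_vk`).
Assume Khale's Theorem 1.1.  For `η > 2/3`, for all large `X`: `ζ₁(s) ≠ 0` for `|Im s| ≤ 3X`,
`Re s ≥ 1 − (log X)^{-η}`. [cite: Khale2024, Theorem 1.1] [cite: MontgomeryVaughan2007, Theorem 6.6] -/
theorem eventually_riemannZeta₁_ne_zero (hK : Khale2024_zeroFreeRegion) {η : ℝ} (hη : 2 / 3 < η) :
    ∀ᶠ X : ℝ in atTop, ∀ s : ℂ, |s.im| ≤ 3 * X → 1 - Real.log X ^ (-η) ≤ s.re →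
      riemannZeta₁ s ≠ 0 :=
  eventually_riemannZeta₁_ne_zero_of_vk (by norm_num) (hasVKZeroFreeRegion_of_khale hK) hη

/-! ### Logarithmic derivatives in the half-width rectangle -/

/-- `‖m/(s − a)‖ ≤ m · (2/δ)` when `‖s − a‖ ≥ δ/2 > 0` (`m ≥ 0`). [folklore] -/
theorem norm_div_le_of_le_norm {m δ : ℝ} (hm : 0 ≤ m) (hδ : 0 < δ) {z : ℂ} (hz : δ / 2 ≤ ‖z‖) :
    ‖(m : ℂ) / z‖ ≤ m * (2 / δ) := by
  have hz0 : 0 < ‖z‖ := lt_of_lt_of_le (by positivity) hz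
  rw [norm_div, Complex.norm_real, Real.norm_of_nonneg hm, div_eq_mul_inv]
  refine mul_le_mul_of_nonneg_left ?_ hm
  rw [inv_le_comm₀ hz0 (by positivity), inv_div]
  exact hz

/-- **`L'/L(s, χ) ≪_A (log X)³` in the half-width rectangle** for `χ ≠ χ₀`, `q ≤ (log X)^A`,
`|Im s| ≤ 2X`, `1 − (log X)^{-η}/2 ≤ Re s ≤ 2` (`2/3 < η ≤ 1`), assuming a Vinogradov–Korobov region
`HasVKZeroFreeRegion c T₀` (`c > 0`): by MV
Lemma 11.1 (`DirichletZFR.exists_logDeriv_package`) `L'/L(s) = ψ(s) + ∑_{a ∈ S} m(a)/(s − a)` with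
`|ψ| ≤ Eℒ`, `ℒ = log q + log(|t| + 4) ≤ (A + 2) log X`, total multiplicity `∑ m(a) ≤ 8(8 + K₀ + E)ℒ²`
(`DirichletZFR.sum_mult_le`), and every zero `a` has `Re a < 1 − (log X)^{-η}`
(`eventually_LFunction_ne_zero_of_vk`), so `|s − a| ≥ (log X)^{-η}/2`; for `Re s > 17/16` the trivial
bound `1/(σ − 1) + K₀`. [cite: MontgomeryVaughan2007, Lemma 11.1 and Theorem 11.4 (proof)] -/
theorem exists_norm_logDeriv_LFunction_le_of_vk {c T₀ : ℝ} (hc : 0 < c)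
    (hVK : HasVKZeroFreeRegion c T₀) {A η : ℝ} (hA : 0 < A) (hη : 2 / 3 < η) (hη1 : η ≤ 1) :
    ∃ C : ℝ, 0 ≤ C ∧ ∀ᶠ X : ℝ in atTop, ∀ (q : ℕ) [NeZero q], (q : ℝ) ≤ Real.log X ^ A →
      ∀ χ : DirichletCharacter ℂ q, χ ≠ 1 → ∀ s : ℂ, |s.im| ≤ 2 * X →
        1 - Real.log X ^ (-η) / 2 ≤ s.re → s.re ≤ 2 →
          χ.LFunction s ≠ 0 ∧ ‖deriv χ.LFunction s / χ.LFunction s‖ ≤ C * Real.log X ^ 3 := by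
  obtain ⟨K₀, hK₀, -, hKχ⟩ := DirichletZFR.exists_norm_logDeriv_le
  obtain ⟨E, hE, hpackage⟩ := DirichletZFR.exists_logDeriv_package
  have hη0 : 0 < η := by linarith
  set C : ℝ := E * (A + 2) + 16 * (8 + K₀ + E) * (A + 2) ^ 2 + (16 + K₀) with hCdef
  refine ⟨C, by positivity, ?_⟩
  filter_upwards [eventually_LFunction_ne_zero_of_vk hc hVK hA hη,
    eventually_rpow_neg_lt hη0 (show (0 : ℝ) < 5 / 64 by norm_num), eventually_ge_atTop (4 : ℝ),
    Real.tendsto_log_atTop.eventually_ge_atTop (1 : ℝ)] with X hzf hsmall hX4 hL1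
  intro q _ hqA χ hχ s hsX hre hre2
  have hq1 : 1 ≤ q := Nat.one_le_iff_ne_zero.2 (NeZero.ne q)
  set L : ℝ := Real.log X with hLdef
  have hL0 : 0 < L := by linarith
  set δ : ℝ := L ^ (-η) with hδdef
  have hδpos : 0 < δ := Real.rpow_pos_of_pos hL0 _
  have hLs : χ.LFunction s ≠ 0 := hzf q hqA χ hχ s (by linarith) (by linarith)
  refine ⟨hLs, ?_⟩
  have hℒ := ell_le_of_scale hA hX4 hL1 hq1 hqA hsX
  have hℒ1 := DirichletZFR.one_le_ell q s.im
  set ℒ : ℝ := Real.log q + Real.log (|s.im| + 4) with hℒdef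
  have hL3 : L ≤ L ^ 3 := by
    calc L = L ^ 1 := (pow_one L).symm
      _ ≤ L ^ 3 := pow_le_pow_right₀ hL1 (by norm_num)
  have hL13 : 1 ≤ L ^ 3 := one_le_pow₀ hL1
  rcases le_or_gt s.re (17 / 16) with hσ | hσ
  · obtain ⟨S, m, ψ, hS, -, hψ, hψb⟩ := hpackage q χ hχ s.im
    have hsc : s - (17 / 16 + s.im * I) = ((s.re - 17 / 16 : ℝ) : ℂ) :=
      Complex.ext (by simp) (by simp)
    have hball : s ∈ closedBall (17 / 16 + s.im * I) (13 / 128) := by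
      rw [mem_closedBall, dist_eq_norm, hsc, Complex.norm_real, Real.norm_eq_abs, abs_le]
      constructor <;> linarith
    have hball' : s ∈ ball (17 / 16 + s.im * I) (13 / 32) := by
      rw [mem_ball, dist_eq_norm, hsc, Complex.norm_real, Real.norm_eq_abs, abs_lt]
      constructor <;> linarith
    have hid := hψ s hball' hLs
    have hsum := DirichletZFR.sum_mult_le χ hχ hK₀ hKχ hS hψ hψb
    have hdist : ∀ a ∈ S, δ / 2 ≤ ‖s - a‖ := by
      intro a ha
      obtain ⟨hLa, -, hadist⟩ := hS a ha
      have him : |a.im - s.im| ≤ 13 / 32 := by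
        calc |a.im - s.im| = |(a - (17 / 16 + s.im * I)).im| := by simp
          _ ≤ ‖a - (17 / 16 + s.im * I)‖ := Complex.abs_im_le_norm _
          _ ≤ 13 / 32 := hadist
      have haim : |a.im| ≤ 3 * X := by
        have := abs_sub_abs_le_abs_sub a.im s.im
        linarith
      have hare : a.re < 1 - δ := by
        by_contra h
        exact hzf q hqA χ hχ a haim (not_lt.1 h) hLa
      calc δ / 2 ≤ s.re - a.re := by linarith
        _ = (s - a).re := by simp
        _ ≤ ‖s - a‖ := Complex.re_le_norm _
    have h1 : ‖∑ a ∈ S, (m a : ℂ) / (s - a)‖ ≤ 2 / δ * ∑ a ∈ S, (m a : ℝ) := by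
      calc ‖∑ a ∈ S, (m a : ℂ) / (s - a)‖ ≤ ∑ a ∈ S, ‖(m a : ℂ) / (s - a)‖ := norm_sum_le _ _
        _ ≤ ∑ a ∈ S, (m a : ℝ) * (2 / δ) := Finset.sum_le_sum fun a ha ↦ by
            have := norm_div_le_of_le_norm (Nat.cast_nonneg (m a)) hδpos (hdist a ha)
            simpa using this
        _ = 2 / δ * ∑ a ∈ S, (m a : ℝ) := by rw [← Finset.sum_mul, mul_comm]
    have h2 : ‖deriv χ.LFunction s / χ.LFunction s‖ ≤
        E * ℒ + 2 / δ * (8 * (8 + K₀ + E) * ℒ ^ 2) := by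
      have heq : deriv χ.LFunction s / χ.LFunction s = ψ s + ∑ a ∈ S, (m a : ℂ) / (s - a) := by
        rw [hid]; ring
      rw [heq]
      refine (norm_add_le _ _).trans (add_le_add (hψb s hball) ?_)
      exact h1.trans (mul_le_mul_of_nonneg_left hsum (by positivity))
    have h3 : 2 / δ ≤ 2 * L := by
      rw [hδdef, Real.rpow_neg hL0.le, div_inv_eq_mul]
      refine mul_le_mul_of_nonneg_left ?_ (by norm_num)
      calc L ^ η ≤ L ^ (1 : ℝ) := Real.rpow_le_rpow_of_exponent_le hL1 hη1
        _ = L := Real.rpow_one L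
    have hℒ0 : 0 ≤ ℒ := by linarith
    have hA2 : 0 < A + 2 := by linarith
    calc ‖deriv χ.LFunction s / χ.LFunction s‖ ≤ E * ℒ + 2 / δ * (8 * (8 + K₀ + E) * ℒ ^ 2) := h2
      _ ≤ E * ((A + 2) * L) + 2 * L * (8 * (8 + K₀ + E) * ((A + 2) * L) ^ 2) := by
          gcongr
      _ = E * (A + 2) * L + 16 * (8 + K₀ + E) * (A + 2) ^ 2 * L ^ 3 := by ring
      _ ≤ E * (A + 2) * L ^ 3 + 16 * (8 + K₀ + E) * (A + 2) ^ 2 * L ^ 3 + (16 + K₀) * L ^ 3 := by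
          have h4 : E * (A + 2) * L ≤ E * (A + 2) * L ^ 3 :=
            mul_le_mul_of_nonneg_left hL3 (by positivity)
          have h5 : 0 ≤ (16 + K₀) * L ^ 3 := by positivity
          linarith
      _ = C * L ^ 3 := by rw [hCdef]; ring
  · have h := hKχ q χ s (by linarith)
    rw [min_eq_left hre2] at h
    have h4 : 1 / (s.re - 1) ≤ 16 := by
      rw [div_le_iff₀ (by linarith)]; linarith
    calc ‖deriv χ.LFunction s / χ.LFunction s‖ ≤ 1 / (s.re - 1) + K₀ := h
      _ ≤ (16 + K₀) * 1 := by linarith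
      _ ≤ (16 + K₀) * L ^ 3 := mul_le_mul_of_nonneg_left hL13 (by positivity)
      _ ≤ C * L ^ 3 := by
          refine mul_le_mul_of_nonneg_right ?_ (by positivity)
          rw [hCdef]
          have : 0 ≤ E * (A + 2) + 16 * (8 + K₀ + E) * (A + 2) ^ 2 := by positivity
          linarith

/-- **`L'/L(s, χ) ≪_A (log X)³` in the half-width rectangle** (Khale's form of
`exists_norm_logDeriv_LFunction_le_of_vk`): for `χ ≠ χ₀`, `q ≤ (log X)^A`, `|Im s| ≤ 2X`,
`1 − (log X)^{-η}/2 ≤ Re s ≤ 2` (`2/3 < η ≤ 1`), assuming Khale's theorem.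
[cite: Khale2024, Theorem 1.1] [cite: MontgomeryVaughan2007, Lemma 11.1 and Theorem 11.4 (proof)] -/
theorem exists_norm_logDeriv_LFunction_le (hK : Khale2024_zeroFreeRegion) {A η : ℝ} (hA : 0 < A)
    (hη : 2 / 3 < η) (hη1 : η ≤ 1) :
    ∃ C : ℝ, 0 ≤ C ∧ ∀ᶠ X : ℝ in atTop, ∀ (q : ℕ) [NeZero q], (q : ℝ) ≤ Real.log X ^ A →
      ∀ χ : DirichletCharacter ℂ q, χ ≠ 1 → ∀ s : ℂ, |s.im| ≤ 2 * X →
        1 - Real.log X ^ (-η) / 2 ≤ s.re → s.re ≤ 2 →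
          χ.LFunction s ≠ 0 ∧ ‖deriv χ.LFunction s / χ.LFunction s‖ ≤ C * Real.log X ^ 3 :=
  exists_norm_logDeriv_LFunction_le_of_vk (by norm_num) (hasVKZeroFreeRegion_of_khale hK) hA hη hη1

/-- **`ζ₁'/ζ₁(s) ≪ (log X)³` in the half-width rectangle** `|Im s| ≤ 2X`,
`1 − (log X)^{-η}/2 ≤ Re s ≤ 2` (`2/3 < η ≤ 1`), assuming a Vinogradov–Korobov region: by MV Lemma 12.1 in the
tree's disc form (`exists_norm_logDeriv_riemannZeta₁_sub_sum_le`, discs `|s − (2 + it)| ≤ 7/4`)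
`ζ₁'/ζ₁(s) = ∑_ρ m(ρ)/(s − ρ) + O(log(|t| + 4))` over the zeros in `|ρ − (2 + it)| ≤ 37/20`, whose
total multiplicity is `≪ log(|t| + 4)` (Jensen, `exists_sum_zetaDiscZeros_le`), each at distance
`≥ (log X)^{-η}/2` from `s` by `eventually_riemannZeta₁_ne_zero_of_vk`.
[cite: MontgomeryVaughan2007, Lemma 12.1] -/
theorem exists_norm_logDeriv_riemannZeta₁_le_of_vk {c T₀ : ℝ} (hc : 0 < c)
    (hVK : HasVKZeroFreeRegion c T₀) {η : ℝ} (hη : 2 / 3 < η) (hη1 : η ≤ 1) :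
    ∃ C : ℝ, 0 ≤ C ∧ ∀ᶠ X : ℝ in atTop, ∀ s : ℂ, |s.im| ≤ 2 * X →
      1 - Real.log X ^ (-η) / 2 ≤ s.re → s.re ≤ 2 →
        riemannZeta₁ s ≠ 0 ∧ ‖deriv riemannZeta₁ s / riemannZeta₁ s‖ ≤ C * Real.log X ^ 3 := by
  obtain ⟨C₁, hC₁, hdisc⟩ := exists_norm_logDeriv_riemannZeta₁_sub_sum_le
  obtain ⟨C₂, hC₂, hcount⟩ := exists_sum_zetaDiscZeros_le
  have hη0 : 0 < η := by linarith
  refine ⟨3 * C₁ + 6 * C₂, by positivity, ?_⟩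
  filter_upwards [eventually_riemannZeta₁_ne_zero_of_vk hc hVK hη,
    eventually_rpow_neg_lt hη0 (show (0 : ℝ) < 1 by norm_num), eventually_ge_atTop (4 : ℝ),
    Real.tendsto_log_atTop.eventually_ge_atTop (1 : ℝ)] with X hzf hsmall hX4 hL1
  intro s hsX hre hre2
  set L : ℝ := Real.log X with hLdef
  have hL0 : 0 < L := by linarith
  set δ : ℝ := L ^ (-η) with hδdef
  have hδpos : 0 < δ := Real.rpow_pos_of_pos hL0 _
  have hζs : riemannZeta₁ s ≠ 0 := hzf s (by linarith) (by linarith)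
  refine ⟨hζs, ?_⟩
  have hsc : s - (2 + s.im * I) = ((s.re - 2 : ℝ) : ℂ) := Complex.ext (by simp) (by simp)
  have hball : s ∈ closedBall (2 + (s.im : ℂ) * I) (7 / 4) := by
    rw [mem_closedBall, dist_eq_norm, hsc, Complex.norm_real, Real.norm_eq_abs, abs_le]
    constructor <;> linarith
  have h := hdisc s.im s hball hζs
  have hlog : Real.log (|s.im| + 4) ≤ 3 * L := by
    have h1A : ((1 : ℕ) : ℝ) ≤ Real.log X ^ (1 : ℝ) := by
      rw [Real.rpow_one, Nat.cast_one]; exact hL1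
    have := ell_le_of_scale one_pos hX4 hL1 le_rfl h1A hsX
    rw [Nat.cast_one, Real.log_one, zero_add] at this
    linarith
  have hdist : ∀ ρ ∈ zetaDiscZeros s.im, δ / 2 ≤ ‖s - ρ‖ := by
    intro ρ hρ
    obtain ⟨hρball, hρzero⟩ := mem_zetaDiscZeros.1 hρ
    have him : |ρ.im - s.im| ≤ 37 / 20 := by
      rw [mem_closedBall, dist_eq_norm] at hρball
      calc |ρ.im - s.im| = |(ρ - (2 + (s.im : ℂ) * I)).im| := by simp
        _ ≤ ‖ρ - (2 + (s.im : ℂ) * I)‖ := Complex.abs_im_le_norm _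
        _ ≤ 37 / 20 := hρball
    have hρim : |ρ.im| ≤ 3 * X := by
      have := abs_sub_abs_le_abs_sub ρ.im s.im
      linarith
    have hρre : ρ.re < 1 - δ := by
      by_contra h'
      exact hzf ρ hρim (not_lt.1 h') hρzero
    calc δ / 2 ≤ s.re - ρ.re := by linarith
      _ = (s - ρ).re := by simp
      _ ≤ ‖s - ρ‖ := Complex.re_le_norm _
  have h1 : ‖∑ ρ ∈ zetaDiscZeros s.im, (zetaDiscDivisor s.im ρ : ℂ) / (s - ρ)‖ ≤
      2 / δ * ∑ ρ ∈ zetaDiscZeros s.im, (zetaDiscDivisor s.im ρ : ℝ) := by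
    calc ‖∑ ρ ∈ zetaDiscZeros s.im, (zetaDiscDivisor s.im ρ : ℂ) / (s - ρ)‖
        ≤ ∑ ρ ∈ zetaDiscZeros s.im, ‖(zetaDiscDivisor s.im ρ : ℂ) / (s - ρ)‖ := norm_sum_le _ _
      _ ≤ ∑ ρ ∈ zetaDiscZeros s.im, (zetaDiscDivisor s.im ρ : ℝ) * (2 / δ) :=
          Finset.sum_le_sum fun ρ hρ ↦ by
            have h0 : (0 : ℝ) ≤ (zetaDiscDivisor s.im ρ : ℝ) := by
              exact_mod_cast zetaDiscDivisor_nonneg s.im ρ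
            have := norm_div_le_of_le_norm h0 hδpos (hdist ρ hρ)
            simpa using this
      _ = 2 / δ * ∑ ρ ∈ zetaDiscZeros s.im, (zetaDiscDivisor s.im ρ : ℝ) := by
          rw [← Finset.sum_mul, mul_comm]
  have h2 : ‖deriv riemannZeta₁ s / riemannZeta₁ s‖ ≤ C₁ * (3 * L) + 2 / δ * (C₂ * (3 * L)) := by
    have heq : deriv riemannZeta₁ s / riemannZeta₁ s =
        (logDeriv riemannZeta₁ s -
          ∑ ρ ∈ zetaDiscZeros s.im, (zetaDiscDivisor s.im ρ : ℂ) / (s - ρ)) +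
          ∑ ρ ∈ zetaDiscZeros s.im, (zetaDiscDivisor s.im ρ : ℂ) / (s - ρ) := by
      rw [logDeriv_apply]; ring
    rw [heq]
    refine (norm_add_le _ _).trans (add_le_add ?_ ?_)
    · exact h.trans (mul_le_mul_of_nonneg_left hlog hC₁.le)
    · refine h1.trans (mul_le_mul_of_nonneg_left ?_ (by positivity))
      exact (hcount s.im).trans (mul_le_mul_of_nonneg_left hlog hC₂.le)
  have h3 : 2 / δ ≤ 2 * L := by
    rw [hδdef, Real.rpow_neg hL0.le, div_inv_eq_mul]
    refine mul_le_mul_of_nonneg_left ?_ (by norm_num)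
    calc L ^ η ≤ L ^ (1 : ℝ) := Real.rpow_le_rpow_of_exponent_le hL1 hη1
      _ = L := Real.rpow_one L
  have hL3 : L ≤ L ^ 3 := by
    calc L = L ^ 1 := (pow_one L).symm
      _ ≤ L ^ 3 := pow_le_pow_right₀ hL1 (by norm_num)
  have hL23 : L ^ 2 ≤ L ^ 3 := pow_le_pow_right₀ hL1 (by norm_num)
  calc ‖deriv riemannZeta₁ s / riemannZeta₁ s‖ ≤ C₁ * (3 * L) + 2 / δ * (C₂ * (3 * L)) := h2
    _ ≤ C₁ * (3 * L) + 2 * L * (C₂ * (3 * L)) := by gcongr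
    _ = 3 * C₁ * L + 6 * C₂ * L ^ 2 := by ring
    _ ≤ 3 * C₁ * L ^ 3 + 6 * C₂ * L ^ 3 := by gcongr
    _ = (3 * C₁ + 6 * C₂) * L ^ 3 := by ring

/-- **`ζ₁'/ζ₁(s) ≪ (log X)³` in the half-width rectangle** (Khale's form of
`exists_norm_logDeriv_riemannZeta₁_le_of_vk`): `|Im s| ≤ 2X`, `1 − (log X)^{-η}/2 ≤ Re s ≤ 2`
(`2/3 < η ≤ 1`), assuming Khale's theorem. [cite: Khale2024, Theorem 1.1]
[cite: MontgomeryVaughan2007, Lemma 12.1] -/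
theorem exists_norm_logDeriv_riemannZeta₁_le (hK : Khale2024_zeroFreeRegion) {η : ℝ}
    (hη : 2 / 3 < η) (hη1 : η ≤ 1) :
    ∃ C : ℝ, 0 ≤ C ∧ ∀ᶠ X : ℝ in atTop, ∀ s : ℂ, |s.im| ≤ 2 * X →
      1 - Real.log X ^ (-η) / 2 ≤ s.re → s.re ≤ 2 →
        riemannZeta₁ s ≠ 0 ∧ ‖deriv riemannZeta₁ s / riemannZeta₁ s‖ ≤ C * Real.log X ^ 3 :=
  exists_norm_logDeriv_riemannZeta₁_le_of_vk (by norm_num) (hasVKZeroFreeRegion_of_khale hK) hη hη1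

/-- **The principal character: `L₁'/L₁(s, χ₀) ≪_A (log X)³`** in the half-width rectangle, for
Mathlib's entire `L₁(s, χ₀) = (s − 1)L(s, χ₀)` (`DirichletCharacter.LFunctionTrivChar₁ q`), which
equals `ζ₁(s) ∏_{p ∣ q}(1 − p^{-s})` (`SiegelWalfisz.LFunctionTrivChar₁_eq`), so that
`‖L₁'/L₁‖ ≤ ‖ζ₁'/ζ₁‖ + 3 log q` (`SiegelWalfisz.norm_logDeriv_LFunctionTrivChar₁_le`) and `L₁ ≠ 0`
there; `q ≤ (log X)^A`; assuming a Vinogradov–Korobov region.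
[cite: MontgomeryVaughan2007, Lemma 11.1 (proof, (4.22))] -/
theorem exists_norm_logDeriv_LFunctionTrivChar₁_le_of_vk {c T₀ : ℝ} (hc : 0 < c)
    (hVK : HasVKZeroFreeRegion c T₀) {A η : ℝ} (hA : 0 < A) (hη : 2 / 3 < η) (hη1 : η ≤ 1) :
    ∃ C : ℝ, 0 ≤ C ∧ ∀ᶠ X : ℝ in atTop, ∀ (q : ℕ) [NeZero q], (q : ℝ) ≤ Real.log X ^ A →
      ∀ s : ℂ, |s.im| ≤ 2 * X → 1 - Real.log X ^ (-η) / 2 ≤ s.re → s.re ≤ 2 →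
        DirichletCharacter.LFunctionTrivChar₁ q s ≠ 0 ∧
          ‖deriv (DirichletCharacter.LFunctionTrivChar₁ q) s /
              DirichletCharacter.LFunctionTrivChar₁ q s‖ ≤ C * Real.log X ^ 3 := by
  obtain ⟨C, hC, hζ⟩ := exists_norm_logDeriv_riemannZeta₁_le_of_vk hc hVK hη hη1
  have hη0 : 0 < η := by linarith
  refine ⟨C + 3 * A, by positivity, ?_⟩
  filter_upwards [hζ, eventually_rpow_neg_lt hη0 (show (0 : ℝ) < 1 / 2 by norm_num),
    eventually_ge_atTop (4 : ℝ), Real.tendsto_log_atTop.eventually_ge_atTop (1 : ℝ)]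
    with X hζX hsmall hX4 hL1
  intro q _ hqA s hsX hre hre2
  have hq1 : 1 ≤ q := Nat.one_le_iff_ne_zero.2 (NeZero.ne q)
  set L : ℝ := Real.log X with hLdef
  have hL0 : 0 < L := by linarith
  obtain ⟨hζs, hb⟩ := hζX s hsX hre hre2
  obtain ⟨hne, hle⟩ := SiegelWalfisz.norm_logDeriv_LFunctionTrivChar₁_le q (s := s) (by linarith) hζs
  refine ⟨hne, hle.trans ?_⟩
  have hlogq : Real.log q ≤ A * L := by
    have h := log_le_of_le_rpow hL0 hq1 hqA
    have h2 : Real.log L ≤ L := by have := Real.log_le_sub_one_of_pos hL0; linarith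
    exact h.trans (mul_le_mul_of_nonneg_left h2 hA.le)
  have hL3 : L ≤ L ^ 3 := by
    calc L = L ^ 1 := (pow_one L).symm
      _ ≤ L ^ 3 := pow_le_pow_right₀ hL1 (by norm_num)
  calc ‖deriv riemannZeta₁ s / riemannZeta₁ s‖ + 3 * Real.log q ≤ C * L ^ 3 + 3 * (A * L) := by
        gcongr
    _ ≤ C * L ^ 3 + 3 * A * L ^ 3 := by
        have : 3 * (A * L) ≤ 3 * A * L ^ 3 := by
          rw [mul_assoc]; exact mul_le_mul_of_nonneg_left (mul_le_mul_of_nonneg_left hL3 hA.le)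
            (by norm_num)
        linarith
    _ = (C + 3 * A) * L ^ 3 := by ring

/-- **The principal character: `L₁'/L₁(s, χ₀) ≪_A (log X)³`** in the half-width rectangle
(Khale's form of `exists_norm_logDeriv_LFunctionTrivChar₁_le_of_vk`), for Mathlib's entire
`L₁(s, χ₀) = (s − 1)L(s, χ₀)`, `q ≤ (log X)^A`, assuming Khale's theorem. [cite: Khale2024, Theorem 1.1]
[cite: MontgomeryVaughan2007, Lemma 11.1 (proof, (4.22))] -/
theorem exists_norm_logDeriv_LFunctionTrivChar₁_le (hK : Khale2024_zeroFreeRegion) {A η : ℝ}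
    (hA : 0 < A) (hη : 2 / 3 < η) (hη1 : η ≤ 1) :
    ∃ C : ℝ, 0 ≤ C ∧ ∀ᶠ X : ℝ in atTop, ∀ (q : ℕ) [NeZero q], (q : ℝ) ≤ Real.log X ^ A →
      ∀ s : ℂ, |s.im| ≤ 2 * X → 1 - Real.log X ^ (-η) / 2 ≤ s.re → s.re ≤ 2 →
        DirichletCharacter.LFunctionTrivChar₁ q s ≠ 0 ∧
          ‖deriv (DirichletCharacter.LFunctionTrivChar₁ q) s /
              DirichletCharacter.LFunctionTrivChar₁ q s‖ ≤ C * Real.log X ^ 3 :=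
  exists_norm_logDeriv_LFunctionTrivChar₁_le_of_vk (by norm_num) (hasVKZeroFreeRegion_of_khale hK)
    hA hη hη1

end VKDirichlet

end Literature.NumberTheory.LFunctions
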